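import Summits.BirchSwinnertonDyer.BirchSwinnertonDyer.Theorems.PrintX8VerticalStevensBridge
import Summits.BirchSwinnertonDyer.BirchSwinnertonDyer.Theorems.PrintX8VerticalStevensPrimeLevel
import Literature.NumberTheory.EllipticCurves.CuspFormLFunctionLevelConductorProofs
import Literature.NumberTheory.EllipticCurves.Rank1Residual.Predicates
import HarnessLib

/-!
# Route `PrintX8`, crux 20622 `MuBoundSmallImageX8` — LINE «vertical Stevens at 3»: curve-level and
# class-wide consequences of the bridge (VS-0 ⟹ VS-1) and the PRIME-CONDUCTOR theorem (route-independent)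

Cell `bsd-print-x8`, seat p1 (gen 4), `--supports stmt-BirchSwinnertonDyer-20622`.  Theorems only; imports no
route file (the by-name step VS-1 ⟹ 20622 over seat p3's p561175 is the sibling `PrintX8VerticalStevensCrux.lean`).
Puts together `PrintX8VerticalStevensBridge` (VS-B: mod-`p` span + `a_p ≢ 1` ⟹ `[·]⁺_f` non-constant mod `p` on
`ℤ[1/p]`) and `PrintX8VerticalStevensPrimeLevel` (THEOREM (T): the span statement at prime level).

## Contents
* §Curves: `cycWindingNonConstantAt_of_spanMod` / `_of_eisSpanGen` (any `E`, `p` odd good, `a_p ≢ 1`),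
  `cycWindingNonConstantAt_three_of_goodSS_of_spanMod` (every `3`-supersingular curve),
  `cycWindingNonConstantX8_of_spanModAtThree`, `cycWindingNonConstantSmallImageX8_of_spanModAtThree` /
  `_of_eisSpanAtThree` — **VS-0 ⟹ VS-1** in the item spelling of `plan/vs/resplit-VS-children.json`.
* §PrimeConductor: **UNCONDITIONAL** — `exists_one_le_norm_sub_of_prime_level` (newform of PRIME level `N`
  with `(ℤ/N)ˣ = ⟨−1,p⟩`, `p` odd, `a_p ≢ 1 (mod p)`: the plus symbol is non-constant mod `p` on
  `ℤ[1/p]`) and `cycWindingNonConstantAt_of_prime_conductor` (curve form; all newform levels equal the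
  conductor by `IsNewformOf.level_eq_conductorNorm_of_squarefree`).  No hypothesis on `ρ̄_{E,p}`.

PARTITION: closes nothing; cells 0.  Beyond print: yes — the prime-level theorem and the bridge are not in the literature searched
by the cell (DOSSIER T24; bsd-f3-mu MEMO-an §10–12 is the source of the mechanism).
-/

-- the summit namespace repeats `BirchSwinnertonDyer` by design (summit = problem); linter moot
set_option linter.dupNamespace false
set_option autoImplicit false

noncomputable section

namespace Summit.BirchSwinnertonDyer.BirchSwinnertonDyer.Theorems.PrintX8VerticalStevens

open scoped Classical NumberField MatrixGroups ModularForm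

open NumberField IsDedekindDomain WeierstrassCurve CongruenceSubgroup Field
  Literature.NumberTheory.EllipticCurves Literature.NumberTheory.EllipticCurves.ModularForms
  Literature.NumberTheory.EllipticCurves.Rank1Residual

section Curves

variable (W : WeierstrassCurve ℚ) [W.IsElliptic] [W.IsGloballyMinimal] (p : ℕ) [Fact p.Prime]

/-- **Curve form of the bridge** (`CycWindingNonConstantAt`, ty2's carrier p557383): for an elliptic
curve `E/ℚ` (globally minimal model `W`), an odd prime `p` of good reduction with `a_p(E) ≢ 1 (mod p)`,
and the mod-`p` span statement `EisSpanModGen M p` (ty2 p561961 / referee R-68) at every level `M` prime to `p`, the cyclotomic winding function of `E` is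
non-constant mod `p`.  (The newform `f` of `E` at level `N` has `p ∤ N`,
`IsNewformOf.dvd_level_iff_dvd_conductorNorm`, rational coefficients, `a_p(f) = a_p(E)`.)  Covers every
`p = 3` supersingular curve (`a₃ ∈ {0, ±3}`: classes X6/X7 at `3` and X8) and the `3`-ordinary curves
with `a₃ ∈ {−1, 2}`; NO hypothesis on the image of `ρ̄_{E,p}`. -/
theorem cycWindingNonConstantAt_of_spanMod (hp2 : p ≠ 2) (hgood : W.HasGoodReductionAtPrime p)
    (hap1 : ¬ (p : ℤ) ∣ W.frobeniusTrace p - 1)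
    (hspan : ∀ (M : ℕ), 0 < M → ¬ p ∣ M → EisSpanModGen M p) :
    CycWindingNonConstantAt W p := by
  intro M _ f hf
  have hp : p.Prime := Fact.out
  have hpM : ¬ p ∣ M := fun h ↦
    (W.dvd_conductorNorm_iff_not_hasGoodReductionAtPrime p).mp
      ((hf.dvd_level_iff_dvd_conductorNorm hp).mp h) hgood
  exact exists_one_le_norm_sub_of_spanMod hf.1 hf.coeffField_eq_bot hp2 hpM
    (cuspCoeff_eq_frobeniusTrace_of_isNewformOf_holds hf hgood) hap1 (hspan M (NeZero.pos M) hpM)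

/-- Curve form from **EIS-SPAN at every level prime to `p`** (the planner's VS-0 shape `EisSpanAtThree`
at `p = 3`). -/
theorem cycWindingNonConstantAt_of_eisSpanGen (hp2 : p ≠ 2) (hgood : W.HasGoodReductionAtPrime p)
    (hap1 : ¬ (p : ℤ) ∣ W.frobeniusTrace p - 1)
    (hE : ∀ (M : ℕ), 0 < M → ¬ p ∣ M → EisSpanGen M p) :
    CycWindingNonConstantAt W p :=
  cycWindingNonConstantAt_of_spanMod W p hp2 hgood hap1
    fun M hM hpM ↦ eisSpanModGen_of_eisSpanGen Fact.out (hE M hM hpM)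

omit [Fact p.Prime] in
/-- **`p = 3` supersingular curves** (`GoodSS W 3`: good reduction at `3` and `3 ∣ a₃`, i.e.
`a₃ ∈ {0, ±3}` — X8 and the `p = 3` part of X6/X7): `3 ∤ a₃ − 1` is automatic, so the mod-`3` span
statement at all levels prime to `3` gives `CycWindingNonConstantAt W 3`. -/
theorem cycWindingNonConstantAt_three_of_goodSS_of_spanMod (hss : GoodSS W 3)
    (hspan : ∀ (M : ℕ), 0 < M → ¬ 3 ∣ M → EisSpanModGen M 3) :
    CycWindingNonConstantAt W 3 := by
  refine cycWindingNonConstantAt_of_spanMod W 3 (by norm_num) hss.1 ?_ hspan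
  rintro ⟨k, hk⟩
  obtain ⟨l, hl⟩ := hss.2
  omega

/-- **VS-0 (mod 3) ⟹ VS-1⁺**: the mod-`3` span statement at every level prime to `3` gives the WIDER
form `CycWindingNonConstantX8` of the planner's sketch (all of class X8, no image hypothesis) — indeed
for every `GoodSS W 3` curve. -/
theorem cycWindingNonConstantX8_of_spanModAtThree
    (hspan : ∀ (M : ℕ), 0 < M → ¬ 3 ∣ M → EisSpanModGen M 3) :
    ∀ (W : WeierstrassCurve ℚ) [W.IsElliptic] [W.IsGloballyMinimal] (p : ℕ) [Fact p.Prime],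
      ClassX8 W p → CycWindingNonConstantAt W p := by
  intro W _ _ p _ hX8
  obtain ⟨rfl, hss, -⟩ := hX8
  exact cycWindingNonConstantAt_three_of_goodSS_of_spanMod W hss hspan

/-- **VS-0 (mod 3) ⟹ VS-1** in the ITEM spelling of the planner's `resplit-VS-children.json` child 1 =
`plan/vs/SketchVS.lean` `VS.CycWindingNonConstantSmallImageX8` (explicit level binder, `¬ Surj`
carried and unused — the mechanism is image-free). -/
theorem cycWindingNonConstantSmallImageX8_of_spanModAtThree
    (hspan : ∀ (M : ℕ), 0 < M → ¬ 3 ∣ M → EisSpanModGen M 3) :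
    ∀ (W : WeierstrassCurve ℚ) [W.IsElliptic] [W.IsGloballyMinimal] (p : ℕ) [Fact p.Prime],
      ClassX8 W p → ¬ Surj W p → ∀ (N : ℕ) (_ : NeZero N) (f : CuspForm (Gamma0 N) 2),
        IsNewformOf W f → ∃ (n : ℕ) (a a' : ℤ),
          1 ≤ ‖((ratPlusSymbol f ((a : ℚ) / (p : ℚ) ^ n) -
            ratPlusSymbol f ((a' : ℚ) / (p : ℚ) ^ n) : ℚ) : ℚ_[p])‖ :=
  fun W _ _ p _ hX8 _ _ _ f hf ↦ cycWindingNonConstantX8_of_spanModAtThree hspan W p hX8 f hf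

/-- The same from **EIS-SPAN at every level prime to `3`** (`EisSpanAtThree` of the planner's sketch,
spelled over ty2's `EisSpanGen`). -/
theorem cycWindingNonConstantSmallImageX8_of_eisSpanAtThree
    (hE : ∀ (M : ℕ), 0 < M → ¬ 3 ∣ M → EisSpanGen M 3) :
    ∀ (W : WeierstrassCurve ℚ) [W.IsElliptic] [W.IsGloballyMinimal] (p : ℕ) [Fact p.Prime],
      ClassX8 W p → ¬ Surj W p → ∀ (N : ℕ) (_ : NeZero N) (f : CuspForm (Gamma0 N) 2),
        IsNewformOf W f → ∃ (n : ℕ) (a a' : ℤ),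
          1 ≤ ‖((ratPlusSymbol f ((a : ℚ) / (p : ℚ) ^ n) -
            ratPlusSymbol f ((a' : ℚ) / (p : ℚ) ^ n) : ℚ) : ℚ_[p])‖ :=
  cycWindingNonConstantSmallImageX8_of_spanModAtThree
    fun M hM h3M ↦ eisSpanModGen_of_eisSpanGen Nat.prime_three (hE M hM h3M)

end Curves


section PrimeConductor

variable {N : ℕ} {f : CuspForm (Gamma0 N) 2} {p : ℕ} [Fact p.Prime]

/-- **UNCONDITIONAL, prime level** (THEOREM (T) + the bridge): for a normalised newform `f` with rational
coefficients of PRIME level `N` such that every unit of `ℤ/N` is `±pᵏ` (`(ℤ/N)ˣ = ⟨−1, p⟩`), an odd prime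
`p ∤ N` with `a_p(f) ≢ 1 (mod p)`: the plus symbol of `f` is non-constant mod `p` on `ℤ[1/p]` —
`1 ≤ ‖[a/pⁿ]⁺_f − [a'/pⁿ]⁺_f‖_p` for some `n, a, a'`.  No hypothesis on the Galois image.
(bsd-f3-mu MEMO-an §10.3 «COROLLARY (vertical Stevens)» at `l = p`, made a theorem.) -/
theorem exists_one_le_norm_sub_of_prime_level [Fact N.Prime] (hf : IsNewform0 f)
    (hQ : coeffField f = ⊥) (hp2 : p ≠ 2) (hpN : ¬ p ∣ N) {ap : ℤ} (hap : cuspCoeff f p = ap)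
    (hap1 : ¬ (p : ℤ) ∣ ap - 1)
    (hT : ∀ x : ZMod N, IsUnit x → ∃ k : ℕ, x = (p : ZMod N) ^ k ∨ x = -((p : ZMod N) ^ k)) :
    ∃ (n : ℕ) (a a' : ℤ),
      1 ≤ ‖((ratPlusSymbol f ((a : ℚ) / (p : ℚ) ^ n) - ratPlusSymbol f ((a' : ℚ) / (p : ℚ) ^ n) : ℚ) :
        ℚ_[p])‖ :=
  haveI : NeZero N := ⟨(Fact.out : N.Prime).ne_zero⟩
  exists_one_le_norm_sub_of_conjSpanGen hf hQ hp2 hpN hap hap1 (conjSpanGen_of_prime p hT)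

/-- **UNCONDITIONAL, prime conductor**: an elliptic curve `E/ℚ` of PRIME conductor `N` with
`(ℤ/N)ˣ = ⟨−1, p⟩`, `p` an odd prime of good reduction with `a_p(E) ≢ 1 (mod p)`, has
`CycWindingNonConstantAt W p` — every newform of `E` has level `N` (`level_eq_conductorNorm_of_squarefree`)
and the prime-level theorem applies.  E.g. every X8 curve of prime conductor `N` with `⟨−1,3⟩ = (ℤ/N)ˣ`. -/
theorem cycWindingNonConstantAt_of_prime_conductor (W : WeierstrassCurve ℚ) [W.IsElliptic]
    [W.IsGloballyMinimal] (hN : (W.conductorNorm ℤ).Prime) (hp2 : p ≠ 2)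
    (hgood : W.HasGoodReductionAtPrime p) (hap1 : ¬ (p : ℤ) ∣ W.frobeniusTrace p - 1)
    (hT : ∀ x : ZMod (W.conductorNorm ℤ), IsUnit x →
      ∃ k : ℕ, x = (p : ZMod (W.conductorNorm ℤ)) ^ k ∨ x = -((p : ZMod (W.conductorNorm ℤ)) ^ k)) :
    CycWindingNonConstantAt W p := by
  intro M _ f hf
  have hp : p.Prime := Fact.out
  have hM : M = W.conductorNorm ℤ := hf.level_eq_conductorNorm_of_squarefree hN.prime.squarefree
  subst hM
  haveI : Fact (W.conductorNorm ℤ).Prime := ⟨hN⟩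
  have hpM : ¬ p ∣ W.conductorNorm ℤ := fun h ↦
    (W.dvd_conductorNorm_iff_not_hasGoodReductionAtPrime p).mp h hgood
  exact exists_one_le_norm_sub_of_prime_level hf.1 hf.coeffField_eq_bot hp2 hpM
    (cuspCoeff_eq_frobeniusTrace_of_isNewformOf_holds hf hgood) hap1 hT

end PrimeConductor



end Summit.BirchSwinnertonDyer.BirchSwinnertonDyer.Theorems.PrintX8VerticalStevens

end
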